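import Summits.ResolutionOfSingularities.ResolutionOfSingularities.Theorems.MarkedTransferCampaignW46ThreefoldsMeasure
import HarnessLib

/-!
# [OURS · L1 W4.6 rung (ii)] The COMPONENT-WISE (∇-centred) reduction from the MONOTONE off-centre shape
# `OffCentreMonotone`, in a regime of bounded dimension — OUR MEASURE v2 (padded top string, `compMeasure`) (proofs)

Cell res-hironaka, LADDER-RESOLUTION rung L (D-0089), slot W4.6, rung (ii); seat res-L1-s46-pv-3 (gen 2). Host route
MarkedTransfer, host item `HypersurfaceOrderReductionDimLeThree` (stmt-16156); `--kind proof --supports` it. Companion of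
`…ThreefoldsMeasure` (the measure and its one-step inequality), `…ThreefoldsPadded` (order plumbing, whole-∇ from the
monotone shape) and `…ThreefoldsRegime` (regime propagation, host words).

HONEST FRAMING. Everything below is OURS: pure logic over the campaign shapes plus the tree's order theory, topology and
blow-up library; NOTHING here is a statement of H. Hironaka's manuscript (2017-03-23, [Hironaka2017]) and nothing asserts
that any statement of it holds. All shapes are HYPOTHESES; the typed `Thm16_6` enters only as a hypothesis. AI review is
weaker than expert review.

## What (the substantive answer to OURS-DESK #38)

The lanes found that `OffCentreLocal` forces `m′ = m`; `OffCentreLocalPad` still does for `n ≥ 1`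
(`length_eq_of_padKey_eq`). The substantively weaker shape is `OffCentreMonotone` («off the centre the `Inv`-string does
not go UP», compatible with `m′ < m`). Under it the g0 measure fails (only `∇(E′) ⊆ ∇′` holds when the top string stalls,
and the number of components is not monotone under inclusion), so this module runs the ∇-centred reduction on OUR
MEASURE v2: (padded top string, `compMeasure d (∇(E_k))`) with the second coordinate compared in the Dershowitz–Manna
order — which is where a DIMENSION BOUND `dim Z_k ≤ d` on the regime is consumed (rung (ii): `d = 3`, the first binder of
stmt-16156). Main theorem: `terminatesNabla_of_decrease_mono` — for a regime inside `dimLE d`,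
`DecreaseAlongSteps → EqualityAlongSteps → StopsMonotone → NablaTopSing → OffCentreMonotone → TerminatesNabla`; rung (ii):
`terminatesNablaII_of_decrease_mono`, `terminatesNablaII_of_thm16_6_mono`, and the host-words form
`not_divergesFromNabla_hostState_of_shapes_mono`.

## Contents

* `no_stalling_descent_wf` — the stalling lemma with a well-founded relation in the second coordinate;
* `Step.padFin_le_of_step_mono` — pointwise comparison across a step (top string never exceeded; equality only on `∇′`);
* `Step.nabla_subset_strictTransformSet_of_padFin_eq_mono` — if the top string stalls, `∇(E′) ⊆ ∇′` (Jacobson);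
* `terminatesNabla_of_decrease_mono` (+ `_thm16_6_mono`), rung (ii) instances, host-words form.

References: Threefolds.lean v4 (p481395); `…ThreefoldsPadded` (p481859); `…ThreefoldsMeasure`; `…ThreefoldsRegime`
(p480316); shared module v3 (p468540) + anchors v2 (p468263). [BaaderNipkow1998] §2.4 via `InvStringOrder`;
[DershowitzManna1979] via Mathlib `Multiset.IsDershowitzMannaLT`; de Jong 1996 4.27 via `Resolution.componentsIn`
[deJong1996]. H. Hironaka, ms. 2017-03-23, Th. 16.6 p.84, §16.3 p.87 — scope only, under adjudication, not cited as fact.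
[Hironaka2017]
-/

noncomputable section

set_option linter.dupNamespace false -- mandated namespace of this single-conjunct summit

open CategoryTheory AlgebraicGeometry TopologicalSpace

namespace Summit.ResolutionOfSingularities.ResolutionOfSingularities.Theorems

namespace CampaignW46

open Literature.AlgebraicGeometry.Resolution
open Literature.AlgebraicGeometry.Hironaka2017
open Literature.AlgebraicGeometry.Hironaka2017.S02Preliminaries
open Literature.AlgebraicGeometry.Hironaka2017.Datum
open Literature.AlgebraicGeometry.Hironaka2017.S15ARSchemes
open Literature.AlgebraicGeometry.Hironaka2017.S16Proof
open Literature.AlgebraicGeometry.Hironaka2017.InvStringOrder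

universe u

variable {n : ℕ} {p : ℕ} [Fact p.Prime] {K : Type u} [Field K] [CharP K p]

/-! ## The stalling lemma with a well-founded second coordinate -/

/-- Pure order theory: a sequence in a well-founded linear order that never increases, paired with a second coordinate
that strictly drops — for a WELL-FOUNDED relation `r` — whenever the first coordinate stalls, cannot be infinite.
[folklore] -/
theorem no_stalling_descent_wf {W : Type*} [LinearOrder W] [WellFoundedLT W] {β : Type*} {r : β → β → Prop}
    (hr : WellFounded r) (e : ℕ → W) (c : ℕ → β) (hle : ∀ k, e (k + 1) ≤ e k)
    (hlt : ∀ k, e (k + 1) = e k → r (c (k + 1)) (c k)) : False := by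
  obtain ⟨w, ⟨k₀, rfl⟩, hmin⟩ := WellFounded.has_min wellFounded_lt (Set.range e) ⟨e 0, 0, rfl⟩
  have hanti : ∀ j, e (k₀ + j) ≤ e k₀ := by
    intro j
    induction j with
    | zero => exact le_rfl
    | succ j ih => exact (hle (k₀ + j)).trans ih
  have hconst : ∀ j, e (k₀ + j) = e k₀ := fun j =>
    le_antisymm (hanti j) (not_lt.mp (hmin _ ⟨k₀ + j, rfl⟩))
  obtain ⟨b, ⟨j₀, rfl⟩, hmin'⟩ := hr.has_min (Set.range fun j => c (k₀ + j)) ⟨_, 0, rfl⟩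
  exact hmin' (c (k₀ + (j₀ + 1))) ⟨j₀ + 1, rfl⟩ (hlt (k₀ + j₀) ((hconst (j₀ + 1)).trans (hconst j₀).symm))

/-! ## One ∇-step under the monotone shape -/

section OneStep

variable {N : Notions.{u} n} {Rd : Reading p K N} {Rg : Regime p K}
variable {A A' : AmbientDatum p K} {E : IdealExponent A.Z} {R : Resume N A E}

/-- POINTWISE COMPARISON under the monotone off-centre shape. Fix a closed `η` realising (T1)/(T2-Sing) of `NablaTopSing`
for `R` and a bound `M ≥ m`. For every closed `ξ′` of `Z′` whose image is singular for `E` and every résumé `R′` of the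
transform read by `Rd`: (a) the padded string of `R′` at `ξ′` is `≤` the top string of `R`; (b) if they are EQUAL then
`ξ′ ∈ ∇′` (strict transform of `∇(E)`). Off the centre only «not above the string downstairs» (`OffCentreMonotone`) is
used; over the centre, Eq. (127) off `D′` and Eq. (128) with `m′ ≤ m` on `D′`. [folklore] -/
theorem Step.padFin_le_of_step_mono (hD : DecreaseAlongSteps N Rd Rg) (hEq : EqualityAlongSteps N Rd Rg)
    (hM : StopsMonotone N Rd Rg) (hL : OffCentreMonotone N Rd Rg) (hRg : Rg A E) (hRd : Rd A E R) (s : Step R A')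
    {η : A.Z}
    (hT1 : ∀ ξ : A.Z, ξ ∈ Literature.AlgebraicGeometry.Hironaka2017.S02Preliminaries.closedPoints A.Z →
      ξ ∈ (R.nabla : Set A.Z) → R.invStr ξ = R.invStr η)
    (hT2 : ∀ ξ : A.Z, ξ ∈ Literature.AlgebraicGeometry.Hironaka2017.S02Preliminaries.closedPoints A.Z →
      ξ ∈ E.sing → ξ ∉ (R.nabla : Set A.Z) → InvString.LexLT (R.invStr ξ) (R.invStr η))
    {M : ℕ} (hMm : R.m ≤ M)
    {E' : IdealExponent A'.Z} (hE' : E' = s.E') (R' : Resume N A' E') (hRd' : Rd A' E' R') {ξ' : A'.Z}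
    (hξ' : ξ' ∈ Literature.AlgebraicGeometry.Hironaka2017.S02Preliminaries.closedPoints A'.Z)
    (hξs : s.π ξ' ∈ E.sing) :
    padFin M (R'.invStr ξ') ≤ padFin M (R.invStr η) ∧
      (padFin M (R'.invStr ξ') = padFin M (R.invStr η) →
        ξ' ∈ strictTransformSet s.π (s.D : Set A.Z) (R.nabla : Set A.Z)) := by
  subst hE'
  have hζ := s.apply_mem_closedPoints hξ'
  have hM' : R'.m ≤ M := (hM A E R hRg hRd A' s R' hRd').trans hMm
  have hlenη : (R.invStr η).length ≤ M := by rw [Resume.length_invStr]; exact hMm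
  have hlenξ' : (R'.invStr ξ').length ≤ M := by rw [Resume.length_invStr]; exact hM'
  by_cases hDζ : s.π ξ' ∈ (s.D : Set A.Z)
  · have hin : s.π ξ' ∈ (R.nabla : Set A.Z) := s.centre.subset_nabla hDζ
    have eζ : R.invStr (s.π ξ') = R.invStr η := hT1 _ hζ hin
    by_cases hDP : ξ' ∈ R.mti.DPrime s.π s.D
    · have h128 : Eq128 R.mti (s.π ξ') R'.mti ξ' := (hEq A E R hRg hRd A' s R' hRd') ξ' hξ' hDP.1
      have hm' : R'.m ≤ R.m := hM A E R hRg hRd A' s R' hRd'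
      have htake : R'.invStr ξ' = (R.invStr η).take R'.m := by
        rw [← eζ]
        change R'.mti.invStr R'.m ξ' = (R.mti.invStr R.m (s.π ξ')).take R'.m
        rw [invStr_eq_take R'.mti hm' ξ']
        exact congrArg (fun L => List.take R'.m L) h128
      have hle : padFin M (R'.invStr ξ') ≤ padFin M (R.invStr η) := by
        rw [htake]
        by_contra hlt
        rw [not_le] at hlt
        have hlen2 : ((R.invStr η).take R'.m).length ≤ M :=
          (List.length_take_le' _ _).trans hlenη
        exact not_lexLT_take (R.invStr η) R'.m ((lexLT_iff_padFin_lt hlenη hlen2).mpr hlt)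
      exact ⟨hle, fun _ => hDP.1⟩
    · have h127 : Eq127 R.mti (s.π ξ') R'.mti ξ' := (hD A E R hRg hRd A' s R' hRd').1 ξ' hξ' hDζ hDP
      change InvString.LexLT (R'.invStr ξ') (R.invStr (s.π ξ')) at h127
      rw [eζ] at h127
      have hlt : padFin M (R'.invStr ξ') < padFin M (R.invStr η) := (lexLT_iff_padFin_lt hlenξ' hlenη).mp h127
      exact ⟨hlt.le, fun heq => absurd heq hlt.ne⟩
  · -- off the centre: not above the string downstairs
    have hmono := hL A E R hRg hRd A' s R' hRd' ξ' hξ' hDζ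
    have hlenζ : (R.invStr (s.π ξ')).length ≤ M := by rw [Resume.length_invStr]; exact hMm
    have hle0 : padFin M (R'.invStr ξ') ≤ padFin M (R.invStr (s.π ξ')) := by
      rw [lexLT_iff_padFin_lt hlenζ hlenξ', not_lt] at hmono
      exact hmono
    by_cases hin : s.π ξ' ∈ (R.nabla : Set A.Z)
    · have eζ : R.invStr (s.π ξ') = R.invStr η := hT1 _ hζ hin
      rw [eζ] at hle0
      exact ⟨hle0, fun _ => strictTransformSet.preimage_diff_subset s.π _ _ ⟨hin, hDζ⟩⟩
    · have hlt' : padFin M (R.invStr (s.π ξ')) < padFin M (R.invStr η) :=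
        (lexLT_iff_padFin_lt hlenζ hlenη).mp (hT2 _ hζ hξs hin)
      have hlt := hle0.trans_lt hlt'
      exact ⟨hlt.le, fun heq => absurd heq hlt.ne⟩

/-- IF THE TOP STRING DOES NOT DROP, THE NEW TERMINAL PLAT LIES IN THE STRICT TRANSFORM OF THE OLD ONE (monotone shape;
INCLUSION only): with closed points `η`, `η′` realising (T1)/(T2-Sing) for `R` resp. (T1) for `R′`, if the padded top
strings agree then `∇(E′) ⊆ ∇′`. Closed points of `∇(E′)` are top points, hence in `∇′` by the pointwise comparison;
the closed set `∇(E′)` is the closure of its closed points (`Z′` Jacobson). [folklore] -/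
theorem Step.nabla_subset_strictTransformSet_of_padFin_eq_mono (hD : DecreaseAlongSteps N Rd Rg)
    (hEq : EqualityAlongSteps N Rd Rg) (hM : StopsMonotone N Rd Rg) (hL : OffCentreMonotone N Rd Rg) (hRg : Rg A E)
    (hRd : Rd A E R) (s : Step R A') {η : A.Z}
    (hT1 : ∀ ξ : A.Z, ξ ∈ Literature.AlgebraicGeometry.Hironaka2017.S02Preliminaries.closedPoints A.Z →
      ξ ∈ (R.nabla : Set A.Z) → R.invStr ξ = R.invStr η)
    (hT2 : ∀ ξ : A.Z, ξ ∈ Literature.AlgebraicGeometry.Hironaka2017.S02Preliminaries.closedPoints A.Z →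
      ξ ∈ E.sing → ξ ∉ (R.nabla : Set A.Z) → InvString.LexLT (R.invStr ξ) (R.invStr η))
    {M : ℕ} (hMm : R.m ≤ M)
    {E' : IdealExponent A'.Z} (hE' : E' = s.E') (R' : Resume N A' E') (hRd' : Rd A' E' R') {η' : A'.Z}
    (hT1' : ∀ ξ' : A'.Z, ξ' ∈ Literature.AlgebraicGeometry.Hironaka2017.S02Preliminaries.closedPoints A'.Z →
      ξ' ∈ (R'.nabla : Set A'.Z) → R'.invStr ξ' = R'.invStr η')
    (heq : padFin M (R'.invStr η') = padFin M (R.invStr η)) :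
    (R'.nabla : Set A'.Z) ⊆ strictTransformSet s.π (s.D : Set A.Z) (R.nabla : Set A.Z) := by
  subst hE'
  haveI := A'.smooth
  haveI : JacobsonSpace A'.Z := LocallyOfFiniteType.jacobsonSpace A'.hom
  have h1 : ∀ ξ' : A'.Z, ξ' ∈ Literature.AlgebraicGeometry.Hironaka2017.S02Preliminaries.closedPoints A'.Z →
      ξ' ∈ (R'.nabla : Set A'.Z) → ξ' ∈ strictTransformSet s.π (s.D : Set A.Z) (R.nabla : Set A.Z) := by
    intro ξ' hc hn
    refine (Step.padFin_le_of_step_mono hD hEq hM hL hRg hRd s hT1 hT2 hMm rfl R' hRd' hc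
      (s.apply_mem_sing (R'.nabla_subset_sing hn))).2 ?_
    rw [hT1' ξ' hc hn]
    exact heq
  have hcl : closure ((R'.nabla : Set A'.Z) ∩ _root_.closedPoints A'.Z) = (R'.nabla : Set A'.Z) :=
    closure_inter_closedPoints R'.nabla.isClosed
  rw [← hcl]
  exact closure_minimal (fun x hx => h1 x hx.2 hx.1) (strictTransformSet.isClosed _ _ _)

end OneStep

/-! ## The component-wise reduction from the monotone shape, in a regime of bounded dimension -/

section Reduction

variable {N : Notions.{u} n} {Rd : Reading p K N} {Rg : Regime p K}

/-- **THE COMPONENT-WISE REDUCTION FROM THE MONOTONE SHAPE.** Let the regime `Rg` lie inside `dimLE d` (ambient Krull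
dimension `≤ d` at every state — rung (ii): `d = 3`). If, for states in `Rg` (notion instance `N`, reading `Rd`), every
admitted step satisfies Eq. (127) off `D′` (`DecreaseAlongSteps`), Eq. (128) on `∇′` (`EqualityAlongSteps`), `m′ ≤ m`
(`StopsMonotone`), the terminal plat is the top `Inv`-stratum of `Sing(E)` (`NablaTopSing`), and off the centre the
`Inv`-string does not go UP across renewal (`OffCentreMonotone`) — then there is NO infinite ∇-centred run inside `Rg`
(`TerminatesNabla`). OUR MEASURE v2: (padded top string `μ_k`, `compMeasure d (∇(E_k))`); `μ_k` never increases
(`Step.padFin_le_of_step_mono`); when it stalls, `∇(E_{k+1}) ⊆ ∇′_k` (`Step.nabla_subset_strictTransformSet_of_padFin_eq_mono`),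
so the component measure drops strictly in the Dershowitz–Manna order (`isDershowitzMannaLT_compMeasure`: the centre
is a component of `∇(E_k)`, the blow-up is an isomorphism off it, `dim Z_{k+1} ≤ d`); both orders are well-founded
(`InvStringOrder` under the length bound `m_k ≤ m_0`; Mathlib `Multiset.wellFounded_isDershowitzMannaLT`), and
`no_stalling_descent_wf` ends the run. Nothing of the manuscript is used or asserted. [folklore] -/
theorem terminatesNabla_of_decrease_mono {d : ℕ} (hdim : ∀ A E, Rg A E → Regime.dimLE d A E)
    (hD : DecreaseAlongSteps N Rd Rg) (hEq : EqualityAlongSteps N Rd Rg) (hM : StopsMonotone N Rd Rg)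
    (hT : NablaTopSing N Rd Rg) (hL : OffCentreMonotone N Rd Rg) : TerminatesNabla N Rd Rg := by
  intro r hRg
  choose η hηn hηc hT1 hT2 using fun k => hT (r.A k) (r.E k) (r.R k) (hRg k) (r.reads k)
  have hmstep : ∀ k, (r.R (k + 1)).m ≤ (r.R k).m := fun k =>
    Step.stops_le hM (hRg k) (r.reads k) (r.step k).toStep (r.E_succ k) (r.R (k + 1)) (r.reads (k + 1))
  have hm : ∀ k, (r.R k).m ≤ (r.R 0).m := by
    intro k
    induction k with
    | zero => exact le_rfl
    | succ k ih => exact (hmstep k).trans ih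
  have hηs : ∀ k, (r.step k).toStep.π (η (k + 1)) ∈ (r.E k).sing := by
    intro k
    have h1 : η (k + 1) ∈ (r.E (k + 1)).sing := (r.R (k + 1)).nabla_subset_sing (hηn (k + 1))
    rw [r.E_succ k] at h1
    exact (r.step k).toStep.apply_mem_sing h1
  -- finiteness of the components of every terminal plat (Noetherian ambient)
  have hfin : ∀ k, (componentsIn ((r.R k).nabla : Set (r.A k).Z)).Finite := fun k => by
    haveI := (r.A k).smooth
    haveI := (r.A k).quasiCompact
    haveI : IsLocallyNoetherian (r.A k).Z := LocallyOfFiniteType.isLocallyNoetherian (r.A k).hom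
    haveI : CompactSpace (r.A k).Z := QuasiCompact.compactSpace_of_compactSpace (r.A k).hom
    haveI : IsNoetherian (r.A k).Z := {}
    exact componentsIn.finite _
  -- the regime's dimension bound, as a bound on codimensions of points
  have hcoh : ∀ (k) (x : (r.A k).Z), Order.coheight x ≤ d := fun k =>
    (topologicalKrullDim_le_iff_forall_coheight_le _ d).mp (hdim _ _ (hRg k))
  have hstep : ∀ k,
      padFin (r.R 0).m ((r.R (k + 1)).invStr (η (k + 1))) ≤ padFin (r.R 0).m ((r.R k).invStr (η k)) ∧
        (padFin (r.R 0).m ((r.R (k + 1)).invStr (η (k + 1))) = padFin (r.R 0).m ((r.R k).invStr (η k)) →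
          Multiset.IsDershowitzMannaLT (compMeasure d ((r.R (k + 1)).nabla : Set (r.A (k + 1)).Z))
            (compMeasure d ((r.R k).nabla : Set (r.A k).Z))) := by
    intro k
    refine ⟨(Step.padFin_le_of_step_mono hD hEq hM hL (hRg k) (r.reads k) (r.step k).toStep (hT1 k) (hT2 k)
      (hm k) (r.E_succ k) (r.R (k + 1)) (r.reads (k + 1)) (hηc (k + 1)) (hηs k)).1, fun heq => ?_⟩
    have hsub := Step.nabla_subset_strictTransformSet_of_padFin_eq_mono hD hEq hM hL (hRg k) (r.reads k)
      (r.step k).toStep (hT1 k) (hT2 k) (hm k) (r.E_succ k) (r.R (k + 1)) (r.reads (k + 1)) (hT1 (k + 1)) heq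
    haveI : IsIso ((r.step k).toStep.π ∣_
        ⟨((r.step k).toStep.D : Set (r.A k).Z)ᶜ, (r.step k).toStep.D.isClosed.isOpen_compl⟩) :=
      (r.step k).toStep.blowup.isIso_morphismRestrict (by simpa using disjoint_compl_left)
    exact isDershowitzMannaLT_compMeasure (r.step k).toStep.π (r.step k).toStep.D.isClosed (r.R k).nabla.isClosed
      (hfin k) (r.step k).component.mem_componentsIn (r.R (k + 1)).nabla.isClosed (hfin (k + 1)) hsub
      (hcoh (k + 1))
  exact no_stalling_descent_wf Multiset.wellFounded_isDershowitzMannaLT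
    (fun k => padFin (r.R 0).m ((r.R k).invStr (η k)))
    (fun k => compMeasure d ((r.R k).nabla : Set (r.A k).Z)) (fun k => (hstep k).1) fun k => (hstep k).2

/-- The monotone component-wise reduction with the one-step shapes from the typed candidate `Thm16_6` (a HYPOTHESIS,
via the anchors): in a regime inside `dimLE d`, `Thm16_6 → StopsMonotone → NablaTopSing → OffCentreMonotone →
TerminatesNabla`. [folklore] -/
theorem terminatesNabla_of_thm16_6_mono [PerfectField K] {d : ℕ} (hdim : ∀ A E, Rg A E → Regime.dimLE d A E)
    {pPosiEmptyAt : ∀ {W : Scheme.{u}}, IdealExponent W → W → Prop}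
    (h : Thm16_6 (p := p) (K := K) n (primeR N Rd) pPosiEmptyAt) (hM : StopsMonotone N Rd Rg)
    (hT : NablaTopSing N Rd Rg) (hL : OffCentreMonotone N Rd Rg) : TerminatesNabla N Rd Rg :=
  terminatesNabla_of_decrease_mono hdim (decreaseAlongSteps_of_thm16_6 N Rd h Rg)
    (equalityAlongSteps_of_thm16_6 N Rd h Rg) hM hT hL

end Reduction

/-! ## Rung (ii): the dimension bound is the first binder of stmt-16156 -/

section RungII

variable (N : Notions.{u} n) (Rd : Reading p K N)

/-- **RUNG (ii), ∇-CENTRED (registered shape), FROM THE MONOTONE OFF-CENTRE SHAPE.** For the NAMED notion instance `N`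
and reading `Rd`: `DecreaseII → EqualityII → StopsMonotoneII → NablaTopSingII → OffCentreMonotoneII → TerminatesNablaII` —
the dimension bound `dim Z ≤ 3` of `regimeII` (the first binder of MarkedTransfer `HypersurfaceOrderReductionDimLeThree`,
stmt-16156) is what makes the component measure well-founded. [folklore] -/
theorem terminatesNablaII_of_decrease_mono (hD : DecreaseII N Rd) (hEq : EqualityII N Rd) (hM : StopsMonotoneII N Rd)
    (hT : NablaTopSingII N Rd) (hL : OffCentreMonotoneII N Rd) : TerminatesNablaII N Rd :=
  terminatesNabla_of_decrease_mono (d := 3) (fun _ _ h => h.1) hD hEq hM hT hL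

/-- RUNG (ii), ∇-centred, monotone shape, with the typed candidate `Thm16_6` AS A HYPOTHESIS: `Thm16_6 →
StopsMonotoneII → NablaTopSingII → OffCentreMonotoneII → TerminatesNablaII`. [folklore] -/
theorem terminatesNablaII_of_thm16_6_mono [PerfectField K]
    {pPosiEmptyAt : ∀ {W : Scheme.{u}}, IdealExponent W → W → Prop}
    (h : Thm16_6 (p := p) (K := K) n (primeR N Rd) pPosiEmptyAt) (hM : StopsMonotoneII N Rd)
    (hT : NablaTopSingII N Rd) (hL : OffCentreMonotoneII N Rd) : TerminatesNablaII N Rd :=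
  terminatesNabla_of_thm16_6_mono (d := 3) (fun _ _ h => h.1) h hM hT hL

end RungII

section Host

variable {k : Type u} [Field k] [CharP k p] {N : Notions.{u} n} {Rd : Reading p k N}

/-- **RUNG (ii) IN THE WORDS OF THE HOST ITEM, MONOTONE SHAPES**: `DecreaseII ∧ EqualityII ∧ StopsMonotoneII ∧
NablaTopSingII ∧ OffCentreMonotoneII` for the named `N`, `Rd` imply that from every input `(k, X, I, m)` of stmt-16156
(`k` perfect of characteristic `p`, `X` integral regular locally of finite type quasi-compact over `k` of Krull dimension
`≤ 3`, `I` effective Cartier, `m`) the ∇-centred typed procedure admits no infinite run (`…ThreefoldsRegime`,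
`not_divergesFromNabla_hostState`). All shapes are HYPOTHESES; 16156's conclusion is neither used nor derived. [folklore] -/
theorem not_divergesFromNabla_hostState_of_shapes_mono [PerfectField k] (hD : DecreaseII N Rd) (hEq : EqualityII N Rd)
    (hM : StopsMonotoneII N Rd) (hT : NablaTopSingII N Rd) (hL : OffCentreMonotoneII N Rd) (X : Scheme.{u})
    (s : X ⟶ Spec (.of k)) [LocallyOfFiniteType s] [QuasiCompact s] [IsIntegral X] (hreg : Scheme.IsRegular X)
    (hdim : topologicalKrullDim X ≤ 3) (I : X.IdealSheafData) (hIc : IsEffectiveCartier I) (m : ℕ) (Rg : Regime p k) :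
    ¬ DivergesFromNabla N Rd Rg
        (⟨X, s, inferInstance, smooth_of_isRegular_of_perfectField s hreg, inferInstance⟩ : AmbientDatum p k) ⟨I, m⟩ :=
  not_divergesFromNabla_hostState (terminatesNablaII_of_decrease_mono N Rd hD hEq hM hT hL) X s hreg hdim I hIc m Rg

end Host

end CampaignW46

end Summit.ResolutionOfSingularities.ResolutionOfSingularities.Theorems

end
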